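import Literature.AnabelianGeometry.EtaleTheta.LogDivisorTower
import Literature.AnabelianGeometry.EtaleTheta.LogDivisorModelTateTowerKummer

/-!
# [EtTh] Def. 3.3 (ii)–(iii): reading a log-divisor TOWER over the tempered `G`-sets of a SUBGROUP `G ≤ Π` (subspace topology) —
# the COMAP of a level structure along a cofinal antitone ℕ-chain, and of the tower (generic, class (b))

S. Mochizuki, *The étale theta function …*, Publ. RIMS **45** (2009) [MochizukiEtTh2009], Def. 3.3 (i)(c) p.72 («for each open
subgroup `H ⊆ Δ`, there exists a [necessarily unique] `i_H ∈ I` such that `Δ^{fil,∞}_{i_H} ⊆ H` …»), (ii) p.73 (the `Δ^fil`-closure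
of a connected tempered covering), (iii) pp.73–74 («the assignments … determine functors») [cite: MochizukiEtTh2009, Def 3.3 (iii) p.73].

abc-iut cell, layer L2; §5-junction S2-repair lane «COMAP-TOWER@CLOSED-SUBGROUP» (β1) of plan/L2/SUBDAG-EtTh-JUNCTION.md
(abc-iut-L2-lead gen 8, R1257; sizing abc-iut-L2-t3 g10 2026-08-27T06:11Z); seat abc-iut-L2-t2 (gen 13).  CLASS (b): definitions +
theorems; no instance / notation / Prop-fact; nothing landed is edited — inputs BY NAME: this lineage's `LevelSystem` (abc-iut-L2-t3,
`TemperedFilterLevels`), `LogDivisorTower` (`LogDivisorTower`), abc-iut-w6-d058's `LogDivisorModel.GaloisAction.comap`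
(`LogDivisorModelTateTowerKummer`), and the pattern of abc-iut-L1-t6's `levelsC` (`…KummerTwistCompatRShear`: `closureC := Δ_n ⊓ compat`,
`lvlC := sInf`, `le_of_closureC_le`).

THE SITUATION.  A tower `T : LogDivisorTower Π L` is read over the connected tempered `Π`-sets `B^temp(Π)⁰`.  The §5 junction after
the (α) repair (`Sec5OfDenseQuotientTemperoid`, abc-iut-L2-t3) wants the SAME tower read over `B^temp(G)⁰` for a subgroup `G ≤ Π`
carrying the subspace topology (the case of record: `G := closure(Im φ) ≤ Compat₃′` for a continuous, not onto, `φ : Π^tp_X̲̲ → Compat₃′`).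
The level structure must be re-indexed: the traces `Δ^{fil,∞}_{e n} ∩ G` of a COFINAL ANTITONE ℕ-CHAIN `e : ℕ → L.I` of levels
(`n ≤ m ⇒ Δ_{e m} ⊆ Δ_{e n}`; every open neighbourhood of `1` in `Π` contains some `Δ_{e n}` — at `levelsC r σ`: `e := id`,
`closureC_antitone`, `exists_closureC_subset_of_isOpen`) may COINCIDE for different `n`, and the tower's transition maps `resFn`/`resDIV`
exist only along `Δ_j ⊆ Δ_i` IN `Π`.  Indexing each trace by its LEAST representative makes «trace′ ⊆ trace ⇒ Δ_{e rep′} ⊆ Δ_{e rep}»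
automatic (antitone + minimality), so every transition and every one of the tower's laws transfers VERBATIM.
* §1 `LevelSystem.comapNat L e he hb G : LevelSystem ↥G` — levels = the traces (`Trace`), `rep` = least representative, the level of
  a connected tempered `G`-set = the trace of the least `n` whose trace fixes it (`lvlNat`, `sInf`; existence from the open stabiliser in
  the subspace topology + `hb` + normality / one orbit); both laws PROVED; key lemma `closure_e_rep_le_of_le`.
* §2 `LogDivisorTower.comap T e he hb G : LogDivisorTower ↥G (L.comapNat e he hb G)` — `Z S := T.Z (e (rep S))`, the actions comapped
  along `G.subtype`, transitions = the tower's along `closure_e_rep_le_of_le`; all fifteen laws = the tower's.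
* §3 dictionary (`rfl`): `comap_Z`, `comap_act`, `comap_resFn`, `comap_resDIV`, and Def. 3.3 (iii) over `B^temp(G)⁰`:
  `DivisorMonoids.ofTower (T.comap …)` has `B₀(Y) = Hom_G(Y, Mero(Z_∞^{(e (rep (lvl Y)))}))`, `Φ₀(Y)`, `div₀` through the comapped
  action (`ofTower_comap_B₀_obj`, `_Φ₀_obj`, `_div₀`).
* (v2) `ofTower_comap_Φ₀_map_apply` / `ofTower_comap_B₀_map_apply` — the transitions over `B^temp(G)⁰` pointwise («pull back,
  then the TOWER's `resDIV`/`resFn` along the least representatives»); `ρ_eq_of_mem_closure_rep_lvl`.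
HONEST FRAMING: interface plumbing over OUR typed records (no tempered Frobenioid of an actual curve is constructed; `G` is any subgroup
with the subspace topology); nothing here bears on [IUTchIII] Cor. 3.12; no side taken; typed ≠ proved — §1's laws are proved.
-/

noncomputable section

namespace Literature.AnabelianGeometry.EtaleTheta

open CategoryTheory Opposite Function Literature.AlgebraicGeometry.Frobenioids
  Literature.AlgebraicGeometry.Frobenioids.QuasiTemperoid Literature.AnabelianGeometry.SemiGraphs

universe u

namespace LevelSystem

variable {P : Type u} [Group P] [TopologicalSpace P] (L : LevelSystem P)
  (e : ℕ → L.I) (he : ∀ ⦃n m : ℕ⦄, n ≤ m → L.closure (e m) ≤ L.closure (e n))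
  (hb : ∀ U : Set P, IsOpen U → (1 : P) ∈ U → ∃ n, (L.closure (e n) : Set P) ⊆ U)
  (G : Subgroup P)

/-! ### §1 The comapped level structure on a subgroup -/

/-- The trace `Δ^{fil,∞}_{e n} ∩ G` of the `n`-th level of the chain, as a subgroup of `G`. [cite: MochizukiEtTh2009, Def 3.3 (i) p.72] -/
def traceNat (n : ℕ) : Subgroup G := (L.closure (e n)).comap G.subtype

/-- Membership in the trace. [cite: MochizukiEtTh2009, Def 3.3 (i) p.72] -/
theorem mem_traceNat_iff (n : ℕ) (g : G) : g ∈ L.traceNat e G n ↔ (g : P) ∈ L.closure (e n) := Iff.rfl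

include he in
/-- The traces are nested along the chain. [cite: MochizukiEtTh2009, Def 3.3 (i) p.72] -/
theorem traceNat_antitone {n m : ℕ} (h : n ≤ m) : L.traceNat e G m ≤ L.traceNat e G n :=
  fun _ hg => he h hg

/-- The traces are normal in `G`. [cite: MochizukiEtTh2009, Def 3.3 (i) p.72] -/
theorem traceNat_normal (n : ℕ) : (L.traceNat e G n).Normal := by
  haveI := L.closure_normal (e n)
  exact Subgroup.Normal.comap inferInstance _

/-- **The index set of the comapped level structure**: the IMAGE `{Δ^{fil,∞}_{e n} ∩ G | n ∈ ℕ}` (each trace counted once).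
[cite: MochizukiEtTh2009, Def 3.3 (i) p.72] -/
def Trace : Type u := {S : Subgroup G // ∃ n, L.traceNat e G n = S}

/-- The LEAST representative of a trace. [cite: MochizukiEtTh2009, Def 3.3 (i) p.72] -/
def rep (S : L.Trace e G) : ℕ := sInf {n | L.traceNat e G n = S.1}

/-- The least representative represents. [cite: MochizukiEtTh2009, Def 3.3 (i) p.72] -/
theorem traceNat_rep (S : L.Trace e G) : L.traceNat e G (L.rep e G S) = S.1 :=
  Nat.sInf_mem (s := {n | L.traceNat e G n = S.1}) S.2

/-- Minimality of the representative. [cite: MochizukiEtTh2009, Def 3.3 (i) p.72] -/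
theorem rep_le {S : L.Trace e G} {n : ℕ} (h : L.traceNat e G n = S.1) : L.rep e G S ≤ n :=
  Nat.sInf_le h

/-- The trace of level `n`, as an index. [cite: MochizukiEtTh2009, Def 3.3 (i) p.72] -/
def traceIdx (n : ℕ) : L.Trace e G := ⟨L.traceNat e G n, n, rfl⟩

/-- [cite: MochizukiEtTh2009, Def 3.3 (i) p.72] -/
theorem rep_traceIdx_le (n : ℕ) : L.rep e G (L.traceIdx e G n) ≤ n := L.rep_le e G rfl

include he in
/-- **KEY LEMMA (antitone + minimality)**: an inclusion of traces forces the inclusion of the LEVELS of their least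
representatives in `Π` — so the tower's transition maps are available along every inclusion of traces.
[cite: MochizukiEtTh2009, Def 3.3 (i) p.72] -/
theorem closure_e_rep_le_of_le {S S' : L.Trace e G} (h : S'.1 ≤ S.1) :
    L.closure (e (L.rep e G S')) ≤ L.closure (e (L.rep e G S)) := by
  rcases le_or_gt (L.rep e G S) (L.rep e G S') with hle | hlt
  · exact he hle
  · -- `rep S' < rep S` gives `S ≤ S'`, whence `S = S'`, contradicting minimality
    have hSS' : S.1 ≤ S'.1 := by
      rw [← L.traceNat_rep e G S, ← L.traceNat_rep e G S']
      exact L.traceNat_antitone e he G hlt.le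
    have heq : S'.1 = S.1 := le_antisymm h hSS'
    have := L.rep_le e G (S := S) ((L.traceNat_rep e G S').trans heq)
    exact absurd this (not_le.mpr hlt)

include hb in
/-- Every open neighbourhood of `1` in `G` (subspace topology) contains some trace. [cite: MochizukiEtTh2009, Def 3.3 (i) p.72] -/
theorem exists_traceNat_subset_of_isOpen {U : Set G} (hU : IsOpen U) (h1 : (1 : G) ∈ U) :
    ∃ n, (L.traceNat e G n : Set G) ⊆ U := by
  obtain ⟨V, hV, hVU⟩ := isOpen_induced_iff.1 hU
  have h1V : (1 : P) ∈ V := by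
    have : (1 : G) ∈ Subtype.val ⁻¹' V := by rw [hVU]; exact h1
    exact this
  obtain ⟨n, hn⟩ := hb V hV h1V
  refine ⟨n, fun g hg => ?_⟩
  rw [← hVU]
  exact hn ((L.mem_traceNat_iff e G n g).1 hg)

include hb in
/-- For a CONNECTED tempered `G`-set some trace fixes every point (open stabiliser + normality + one orbit).
[cite: MochizukiEtTh2009, Def 3.3 (ii) p.73] -/
theorem exists_traceNat_fixes (Y : ConnectedPart (BTemp G)) :
    ∃ n, ∀ g ∈ L.traceNat e G n, ∀ y : Y.obj.obj.V, Y.obj.obj.ρ g y = y := by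
  obtain ⟨y₀⟩ := BTempConnected.nonempty_of_isConnectedObj Y.obj Y.property
  obtain ⟨n, hn⟩ := L.exists_traceNat_subset_of_isOpen e hb G (Y.obj.property.2 y₀) (BTempConnected.ρ_one_apply Y.obj y₀)
  haveI := L.traceNat_normal e G n
  refine ⟨n, fun g hg y => ?_⟩
  obtain ⟨h, rfl⟩ := BTempConnected.exists_ρ_eq_of_isConnectedObj Y.obj Y.property y₀ y
  have hc : h⁻¹ * g * h⁻¹⁻¹ ∈ L.traceNat e G n := (L.traceNat_normal e G n).conj_mem g hg h⁻¹
  rw [inv_inv] at hc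
  have hfix : Y.obj.obj.ρ (h⁻¹ * g * h) y₀ = y₀ := hn hc
  rw [← BTempConnected.ρ_mul_apply, show g * h = h * (h⁻¹ * g * h) by group, BTempConnected.ρ_mul_apply, hfix]

/-- The least `n` whose trace fixes the connected tempered `G`-set `Y`. [cite: MochizukiEtTh2009, Def 3.3 (ii) p.73] -/
def lvlNat (Y : ConnectedPart (BTemp G)) : ℕ := sInf {n | ∀ g ∈ L.traceNat e G n, ∀ y : Y.obj.obj.V, Y.obj.obj.ρ g y = y}

include hb in
/-- The trace of level `lvlNat Y` fixes `Y`. [cite: MochizukiEtTh2009, Def 3.3 (ii) p.73] -/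
theorem traceNat_lvlNat_fixes (Y : ConnectedPart (BTemp G)) :
    ∀ g ∈ L.traceNat e G (L.lvlNat e G Y), ∀ y : Y.obj.obj.V, Y.obj.obj.ρ g y = y :=
  Nat.sInf_mem (s := {n | ∀ g ∈ L.traceNat e G n, ∀ y : Y.obj.obj.V, Y.obj.obj.ρ g y = y}) (L.exists_traceNat_fixes e hb G Y)

/-- Minimality of `lvlNat`. [cite: MochizukiEtTh2009, Def 3.3 (i) p.72] -/
theorem lvlNat_le {Y : ConnectedPart (BTemp G)} {n : ℕ} (h : ∀ g ∈ L.traceNat e G n, ∀ y : Y.obj.obj.V, Y.obj.obj.ρ g y = y) :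
    L.lvlNat e G Y ≤ n :=
  Nat.sInf_le h

include hb in
/-- `lvlNat` is monotone along covering maps `Y' → Y` (what fixes `Y'` fixes its image `Y`). [cite: MochizukiEtTh2009, Def 3.3 (i) p.72] -/
theorem lvlNat_le_of_hom {Y Y' : ConnectedPart (BTemp G)} (f : Y' ⟶ Y) : L.lvlNat e G Y ≤ L.lvlNat e G Y' := by
  obtain ⟨y'₀⟩ := BTempConnected.nonempty_of_isConnectedObj Y'.obj Y'.property
  refine L.lvlNat_le e G fun g hg y => ?_
  obtain ⟨y', rfl⟩ := BTempConnected.surjective_of_isConnectedObj y'₀ Y.property f.hom y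
  rw [← BTempConnected.hom_ρ, L.traceNat_lvlNat_fixes e hb G Y' g hg y']

/-- **The comapped level structure on `G`** (Def. 3.3 (i)(c)/(ii) read on the tempered `G`-sets): levels = the traces
`Δ^{fil,∞}_{e n} ∩ G` (each once), the level of a connected tempered `G`-set = the trace of the least `n` fixing it; BOTH laws
PROVED. [cite: MochizukiEtTh2009, Def 3.3 (ii) p.73] -/
def comapNat : LevelSystem G where
  I := L.Trace e G
  closure S := S.1
  closure_normal S := by rw [← L.traceNat_rep e G S]; exact L.traceNat_normal e G _
  lvl Y := L.traceIdx e G (L.lvlNat e G Y)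
  closure_lvl_act Y g hg y := L.traceNat_lvlNat_fixes e hb G Y g hg y
  closure_lvl_mono f := L.traceNat_antitone e he G (L.lvlNat_le_of_hom e hb G f)

/-- The levels of `comapNat` are the traces. [cite: MochizukiEtTh2009, Def 3.3 (i) p.72] -/
theorem comapNat_closure (S : (L.comapNat e he hb G).I) : (L.comapNat e he hb G).closure S = S.1 := rfl

/-- The level of a connected tempered `G`-set is the trace of level `lvlNat Y`. [cite: MochizukiEtTh2009, Def 3.3 (ii) p.73] -/
theorem comapNat_closure_lvl (Y : ConnectedPart (BTemp G)) :
    (L.comapNat e he hb G).closure ((L.comapNat e he hb G).lvl Y) = L.traceNat e G (L.lvlNat e G Y) := rfl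

/-- Membership in a level of `comapNat`, read in `Π` through the least representative. [cite: MochizukiEtTh2009, Def 3.3 (i) p.72] -/
theorem mem_comapNat_closure_iff (S : (L.comapNat e he hb G).I) (g : G) :
    g ∈ (L.comapNat e he hb G).closure S ↔ (g : P) ∈ L.closure (e (L.rep e G S)) := by
  rw [comapNat_closure, ← L.traceNat_rep e G S]
  rfl

end LevelSystem

/-! ### §2 The comapped tower -/

namespace LogDivisorTower

variable {P : Type u} [Group P] [TopologicalSpace P] {L : LevelSystem P} (T : LogDivisorTower P L)
  (e : ℕ → L.I) (he : ∀ ⦃n m : ℕ⦄, n ≤ m → L.closure (e m) ≤ L.closure (e n))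
  (hb : ∀ U : Set P, IsOpen U → (1 : P) ∈ U → ∃ n, (L.closure (e n) : Set P) ⊆ U)
  (G : Subgroup P)

/-- **The comapped tower**: the tower `T` over `Π` read over the tempered `G`-sets of the subgroup `G ≤ Π` — level `S` (a trace) carries
the datum `Z_∞^{(e (rep S))}` with the `G`-action comapped along `G ≤ Π`, and the transitions of `T` along `closure_e_rep_le_of_le`;
every law is the tower's. [cite: MochizukiEtTh2009, Def 3.3 (iii) p.73] -/
def comap : LogDivisorTower G (L.comapNat e he hb G) where
  Z S := T.Z (e (L.rep e G S))
  cuspLaws _ := T.cuspLaws _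
  act S := (T.act (e (L.rep e G S))).comap G.subtype
  act_closure_fn S g hg := T.act_closure_fn _ _ ((L.mem_comapNat_closure_iff e he hb G S g).1 hg)
  act_closure_div S g hg := T.act_closure_div _ _ ((L.mem_comapNat_closure_iff e he hb G S g).1 hg)
  resFn h := T.resFn (L.closure_e_rep_le_of_le e he G h)
  resDIV h := T.resDIV (L.closure_e_rep_le_of_le e he G h)
  resFn_refl _ f := T.resFn_refl _ f
  resFn_trans _ _ f := T.resFn_trans _ _ f
  resDIV_refl _ d := T.resDIV_refl _ d
  resDIV_trans _ _ d := T.resDIV_trans _ _ d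
  resFn_injective _ := T.resFn_injective _
  resFn_mem_logMero _ _ hf := T.resFn_mem_logMero _ hf
  resFn_mem_const _ _ hf := T.resFn_mem_const _ hf
  resFn_mem_intConst _ _ hf := T.resFn_mem_intConst _ hf
  resDIV_mem_DIVplus _ _ hd := T.resDIV_mem_DIVplus _ hd
  resDIV_mem_Div _ _ hd := T.resDIV_mem_Div _ hd
  resDIV_mem_nonCuspidal _ _ hd := T.resDIV_mem_nonCuspidal _ hd
  resDIV_mem_cuspidal _ _ hd := T.resDIV_mem_cuspidal _ hd
  divisor_resFn _ f := T.divisor_resFn _ f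
  resFn_act _ g f := T.resFn_act _ (g : P) f
  resDIV_act _ g d := T.resDIV_act _ (g : P) d

/-! ### §3 Dictionary -/

/-- Level data of the comapped tower. [cite: MochizukiEtTh2009, Def 3.3 (iii) p.73] -/
theorem comap_Z (S : (L.comapNat e he hb G).I) : (T.comap e he hb G).Z S = T.Z (e (L.rep e G S)) := rfl

/-- The actions of the comapped tower are the tower's, comapped along `G ≤ Π`. [cite: MochizukiEtTh2009, Def 3.3 (iii) p.73] -/
theorem comap_act (S : (L.comapNat e he hb G).I) :
    (T.comap e he hb G).act S = (T.act (e (L.rep e G S))).comap G.subtype := rfl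

/-- The comapped action on functions. [cite: MochizukiEtTh2009, Def 3.3 (iii) p.73] -/
theorem comap_act_actFn (S : (L.comapNat e he hb G).I) (g : G) :
    ((T.comap e he hb G).act S).actFn g = (T.act (e (L.rep e G S))).actFn (g : P) := rfl

/-- The comapped action on log-divisors. [cite: MochizukiEtTh2009, Def 3.3 (iii) p.73] -/
theorem comap_act_actDIV (S : (L.comapNat e he hb G).I) (g : G) :
    ((T.comap e he hb G).act S).actDIV g = (T.act (e (L.rep e G S))).actDIV (g : P) := rfl

/-- Transitions on functions are the tower's along the least representatives. [cite: MochizukiEtTh2009, Def 3.3 (iii) p.73] -/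
theorem comap_resFn {S S' : (L.comapNat e he hb G).I} (h : (L.comapNat e he hb G).closure S' ≤ (L.comapNat e he hb G).closure S)
    (f : (T.Z (e (L.rep e G S))).Fn) :
    (T.comap e he hb G).resFn h f = T.resFn (L.closure_e_rep_le_of_le e he G h) f := rfl

/-- Transitions on log-divisors are the tower's along the least representatives. [cite: MochizukiEtTh2009, Def 3.3 (iii) p.73] -/
theorem comap_resDIV {S S' : (L.comapNat e he hb G).I} (h : (L.comapNat e he hb G).closure S' ≤ (L.comapNat e he hb G).closure S)
    (d : (T.Z (e (L.rep e G S))).DIV) :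
    (T.comap e he hb G).resDIV h d = T.resDIV (L.closure_e_rep_le_of_le e he G h) d := rfl

/-- **Def. 3.3 (iii) over `B^temp(G)⁰`, `B₀`**: for a connected tempered `G`-set `Y`, `B₀(Y) = Hom_G(Y, Mero(Z_∞^{(e (rep (lvl Y)))}))`
through the comapped action. [cite: MochizukiEtTh2009, Def 3.3 (iii) p.74] -/
theorem ofTower_comap_B₀_obj (Y : (ConnectedPart (BTemp G))ᵒᵖ) :
    (DivisorMonoids.ofTower (T.comap e he hb G)).B₀.obj Y =
      CommMonCat.of (((T.act (e (L.rep e G ((L.comapNat e he hb G).lvl Y.unop)))).comap G.subtype).bZero (gset Y.unop)) := rfl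

/-- **Def. 3.3 (iii) over `B^temp(G)⁰`, `Φ₀`.** [cite: MochizukiEtTh2009, Def 3.3 (iii) p.74] -/
theorem ofTower_comap_Φ₀_obj (Y : (ConnectedPart (BTemp G))ᵒᵖ) :
    (DivisorMonoids.ofTower (T.comap e he hb G)).Φ₀.obj Y =
      CommMonCat.of (((T.act (e (L.rep e G ((L.comapNat e he hb G).lvl Y.unop)))).comap G.subtype).phiZero (gset Y.unop)) := rfl

/-- **Def. 3.3 (iii) over `B^temp(G)⁰`, `div₀`.** [cite: MochizukiEtTh2009, Def 3.3 (iii) p.74] -/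
theorem ofTower_comap_div₀ (Y : (ConnectedPart (BTemp G))ᵒᵖ) :
    (DivisorMonoids.ofTower (T.comap e he hb G)).div₀ Y =
      ((T.act (e (L.rep e G ((L.comapNat e he hb G).lvl Y.unop)))).comap G.subtype).divZeroHom (gset Y.unop) := rfl

/-- The level at which a connected tempered `G`-set is read is at most any `n` whose trace fixes it (minimality, for the
users' level bookkeeping). [cite: MochizukiEtTh2009, Def 3.3 (i) p.72] -/
theorem rep_lvl_le {Y : ConnectedPart (BTemp G)} {n : ℕ}
    (h : ∀ g ∈ L.traceNat e G n, ∀ y : Y.obj.obj.V, Y.obj.obj.ρ g y = y) :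
    L.rep e G ((L.comapNat e he hb G).lvl Y) ≤ n :=
  (L.rep_traceIdx_le e G _).trans (L.lvlNat_le e G h)

/-- **Transitions of `Φ₀` over `B^temp(G)⁰`, pointwise** («pull back, then change level» — the level change is the TOWER's `resDIV`
along the least representatives): for a covering map `f : Y' → Y` of connected tempered `G`-sets, `φ ∈ Φ₀(Y)` and `s ∈ Y'`,
`(Φ₀(f) φ)(s) = T.resDIV _ (φ (f s))`.  (The (β2) holder's `hΦinj` / `hΦrefl` inputs.) [cite: MochizukiEtTh2009, Def 3.3 (iii) p.74] -/
theorem ofTower_comap_Φ₀_map_apply {Y Y' : (ConnectedPart (BTemp G))ᵒᵖ} (f : Y ⟶ Y')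
    (φ : ((T.comap e he hb G).act ((L.comapNat e he hb G).lvl Y.unop)).phiZero (gset Y.unop)) (s : (gset Y'.unop).V) :
    (((DivisorMonoids.ofTower (T.comap e he hb G)).Φ₀.map f).hom φ).1 s =
      T.resDIV (L.closure_e_rep_le_of_le e he G ((L.comapNat e he hb G).closure_lvl_mono f.unop)) (φ.1 (f.unop.hom.hom.hom s)) := rfl

/-- **Transitions of `B₀` over `B^temp(G)⁰`, pointwise**: `(B₀(f) b)(s) = T.resFn _ (b (f s))`. [cite: MochizukiEtTh2009, Def 3.3 (iii) p.74] -/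
theorem ofTower_comap_B₀_map_apply {Y Y' : (ConnectedPart (BTemp G))ᵒᵖ} (f : Y ⟶ Y')
    (b : ((T.comap e he hb G).act ((L.comapNat e he hb G).lvl Y.unop)).bZero (gset Y.unop)) (s : (gset Y'.unop).V) :
    (((DivisorMonoids.ofTower (T.comap e he hb G)).B₀.map f).hom b).1 s =
      T.resFn (L.closure_e_rep_le_of_le e he G ((L.comapNat e he hb G).closure_lvl_mono f.unop)) (b.1 (f.unop.hom.hom.hom s)) := rfl

/-- The trace fixing a connected tempered `G`-set `Y` at its level: every `g ∈ G` whose image lies in `Δ_{e (rep (lvl Y))}` acts trivially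
on `Y` (the comapped tower's `act_closure` at the reading level, for the (β2)/(β3) holders). [cite: MochizukiEtTh2009, Def 3.3 (ii) p.73] -/
theorem ρ_eq_of_mem_closure_rep_lvl (Y : ConnectedPart (BTemp G)) {g : G}
    (hg : (g : P) ∈ L.closure (e (L.rep e G ((L.comapNat e he hb G).lvl Y)))) (y : Y.obj.obj.V) : Y.obj.obj.ρ g y = y :=
  (L.comapNat e he hb G).closure_lvl_act Y g ((L.mem_comapNat_closure_iff e he hb G _ g).2 hg) y

end LogDivisorTower

end Literature.AnabelianGeometry.EtaleTheta

end
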